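import Summits.Ventures.HSemireg.ContractionSpanThetaSecantDarboux
import Mathlib.LinearAlgebra.CliffordAlgebra.Grading
import HarnessLib

/-!
# Venture HSemireg — the three factor spans of a theta-secant class are INDEPENDENT
# (`Λ^{≥2,even}`-part, odd part, and the line `K·x`: parity plus one degree-`2` projection)

HONEST FRAMING. Pure linear algebra continuing `ContractionSpanThetaSecant(Darboux).lean` (seat p6 of the
computation cell `pub-hsemireg`). It supplies, for the theta-divisor 2-secant factor `x = a·1 + b·e^{c}`, the
independence hypothesis `iSupIndep ![span, span₁, K·x]` of seat p4's Künneth count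
(`ContractionSpanKunnethRank.lean`, `finrank_span_mul_eq`): the degree-two span `W ⊔ e^{c}W` and the line `K·x` are EVEN,
the degree-one span `ι(L) ⊔ e^{c}ι(L)` is ODD (Mathlib's `CliffordAlgebra.evenOdd`), and `K·x ∩ (W ⊔ e^{c}W) = 0` because the
degree-`2` component of `x` is `b·c ∉ Λ²L` while that of `w + (e^{c} - 1)w'` is `w ∈ Λ²L`. Nothing here is a claim about any
variety; nothing here says that HC / HC_CM / HC_AV holds. Everything is PROVED; no named fact, no new definition.
References: [BourbakiAlgebre1a3] Ch. III §7 no. 1 (gradings of `Λ V`), §11 no. 9; [BuchweitzFlenner2008HH] Prop. 6.4.4.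
-/

noncomputable section

open CliffordAlgebra (contractLeft)
open ExteriorAlgebra (ι)
open Module
open Literature.AlgebraicGeometry.Motives

namespace Summit.Ventures.HSemireg

namespace ContractionSpan

section Parity
variable {K : Type*} [CommRing K] {V : Type*} [AddCommGroup V] [Module K V]

/-- `Λᵏ V` lies in the parity-`k` part. [cite: BourbakiAlgebre1a3, Ch. III §7 no. 1] -/
theorem exteriorPower_le_evenOdd (k : ℕ) :
    ⋀[K]^k V ≤ CliffordAlgebra.evenOdd (0 : QuadraticForm K V) (k : ZMod 2) := by
  rw [ExteriorAlgebra.exteriorPower, CliffordAlgebra.evenOdd]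
  exact le_iSup (fun j : {n : ℕ // (n : ZMod 2) = (k : ZMod 2)} => LinearMap.range (CliffordAlgebra.ι _) ^ (j : ℕ)) ⟨k, rfl⟩

/-- Powers of an even element are even. [cite: BourbakiAlgebre1a3, Ch. III §7 no. 1] -/
theorem pow_mem_evenOdd_zero {c : ExteriorAlgebra K V} (hc : c ∈ CliffordAlgebra.evenOdd (0 : QuadraticForm K V) 0)
    (k : ℕ) : c ^ k ∈ CliffordAlgebra.evenOdd (0 : QuadraticForm K V) 0 := by
  induction k with
  | zero => rw [pow_zero]; exact CliffordAlgebra.one_le_evenOdd_zero _ (Submodule.mem_one.mpr ⟨1, by rw [map_one]⟩)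
  | succ k ih =>
    rw [pow_succ]
    have h := CliffordAlgebra.evenOdd_mul_le (0 : QuadraticForm K V) 0 0 (Submodule.mul_mem_mul ih hc)
    rwa [add_zero] at h

/-- `even · (parity i) ⊆ parity i`. [cite: BourbakiAlgebre1a3, Ch. III §7 no. 1] -/
theorem mul_mem_evenOdd_of_mem_zero {E y : ExteriorAlgebra K V} (hE : E ∈ CliffordAlgebra.evenOdd (0 : QuadraticForm K V) 0)
    {i : ZMod 2} (hy : y ∈ CliffordAlgebra.evenOdd (0 : QuadraticForm K V) i) :
    E * y ∈ CliffordAlgebra.evenOdd (0 : QuadraticForm K V) i := by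
  have h := CliffordAlgebra.evenOdd_mul_le (0 : QuadraticForm K V) 0 i (Submodule.mul_mem_mul hE hy)
  rwa [zero_add] at h

/-- A block and its `E`-multiple stay in the parity of the block, for `E` even. [cite: BourbakiAlgebre1a3, Ch. III §7 no. 1] -/
theorem sup_map_mulLeft_le_evenOdd {W : Submodule K (ExteriorAlgebra K V)} {i : ZMod 2}
    (hW : W ≤ CliffordAlgebra.evenOdd (0 : QuadraticForm K V) i) {E : ExteriorAlgebra K V}
    (hE : E ∈ CliffordAlgebra.evenOdd (0 : QuadraticForm K V) 0) :
    W ⊔ W.map (LinearMap.mulLeft K E) ≤ CliffordAlgebra.evenOdd (0 : QuadraticForm K V) i :=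
  sup_le hW (Submodule.map_le_iff_le_comap.mpr fun _ hw => mul_mem_evenOdd_of_mem_zero hE (hW hw))

/-- **Three submodules, two even and one odd, with the even two disjoint, are independent** (both orders of the
`Fin 3`-family, as consumed by `ContractionSpanKunnethRank.finrank_span_mul_eq`). [cite: BourbakiAlgebre1a3, Ch. III §7 no. 1] -/
theorem iSupIndep_three_of_parity {P₀ P₁ P₂ Ev Od : Submodule K (ExteriorAlgebra K V)} (hEO : Disjoint Ev Od)
    (h₀ : P₀ ≤ Ev) (h₁ : P₁ ≤ Od) (h₂ : P₂ ≤ Ev) (h₀₂ : Disjoint P₀ P₂) :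
    iSupIndep ![P₂, P₁, P₀] ∧ iSupIndep ![P₀, P₁, P₂] := by
  -- the three pairwise-with-sup disjointness statements
  have hOd : ∀ {y z : ExteriorAlgebra K V}, y ∈ Od → z ∈ Ev → y + z ∈ Ev → y = 0 := fun {y z} hy hz hyz =>
    (hEO.symm.le_bot ⟨hy, by simpa using Submodule.sub_mem _ hyz hz⟩ : y ∈ (⊥ : Submodule K _))
  have d2 : Disjoint P₂ (P₁ ⊔ P₀) := by
    rw [Submodule.disjoint_def]
    intro y hy2 hy
    obtain ⟨y₁, hy₁, y₀, hy₀, rfl⟩ := Submodule.mem_sup.mp hy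
    obtain rfl : y₁ = 0 := hOd (h₁ hy₁) (h₀ hy₀) (h₂ hy2)
    rw [zero_add] at hy2 ⊢
    exact h₀₂.le_bot ⟨hy₀, hy2⟩
  have d1 : Disjoint P₁ (P₂ ⊔ P₀) := by
    rw [Submodule.disjoint_def]
    intro y hy1 hy
    exact hEO.symm.le_bot ⟨h₁ hy1, (sup_le h₂ h₀) hy⟩
  have d0 : Disjoint P₀ (P₂ ⊔ P₁) := by
    rw [Submodule.disjoint_def]
    intro y hy0 hy
    obtain ⟨y₂, hy₂, y₁, hy₁, rfl⟩ := Submodule.mem_sup.mp hy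
    obtain rfl : y₁ = 0 := hOd (h₁ hy₁) (h₂ hy₂) (by rw [add_comm]; exact h₀ hy0)
    rw [add_zero] at hy0 ⊢
    exact h₀₂.le_bot ⟨hy0, hy₂⟩
  have key : ∀ {Q₀ Q₁ Q₂ : Submodule K (ExteriorAlgebra K V)}, Disjoint Q₀ (Q₁ ⊔ Q₂) → Disjoint Q₁ (Q₀ ⊔ Q₂) →
      Disjoint Q₂ (Q₀ ⊔ Q₁) → iSupIndep ![Q₀, Q₁, Q₂] := by
    intro Q₀ Q₁ Q₂ e₀ e₁ e₂
    rw [iSupIndep_def]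
    intro i
    fin_cases i
    · refine e₀.mono_right (iSup₂_le fun j hj => ?_)
      fin_cases j
      · exact absurd rfl hj
      · exact le_sup_left
      · exact le_sup_right
    · refine e₁.mono_right (iSup₂_le fun j hj => ?_)
      fin_cases j
      · exact le_sup_left
      · exact absurd rfl hj
      · exact le_sup_right
    · refine e₂.mono_right (iSup₂_le fun j hj => ?_)
      fin_cases j
      · exact le_sup_left
      · exact le_sup_right
      · exact absurd rfl hj
  exact ⟨key d2 d1 d0, key (by rwa [sup_comm] at d0) (by rwa [sup_comm] at d1) (by rwa [sup_comm] at d2)⟩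

end Parity

/-! ### The degree-`2` component and the line `K·x` -/

section Field
variable {K : Type*} [Field K] [CharZero K] {V : Type*} [AddCommGroup V] [Module K V]

omit [CharZero K] in
/-- Splitting off the first two terms: `Σ_{k<M+2} cᵏ/k! = 1 + c + Σ_{k<M} c^{k+2}/(k+2)!`. [folklore] -/
theorem expSum_eq_one_add_add (c : ExteriorAlgebra K V) (M : ℕ) :
    (∑ k ∈ Finset.range (M + 2), ((k.factorial : K)⁻¹) • c ^ k) =
      1 + c + ∑ k ∈ Finset.range M, (((k + 2).factorial : K)⁻¹) • c ^ (k + 2) := by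
  rw [Finset.sum_range_succ' _ (M + 1), Finset.sum_range_succ' _ M, pow_zero, Nat.factorial_zero, Nat.cast_one, inv_one,
    one_smul, zero_add, pow_one, Nat.factorial_one, Nat.cast_one, inv_one, one_smul]
  abel

omit [CharZero K] in
/-- The tail `Σ_{k<M} c^{k+2}/(k+2)!` lies in degrees `≠ 2` (each term has degree `2k + 4`), for `c ∈ Λ²`.
[cite: BourbakiAlgebre1a3, Ch. III §7 no. 1] -/
theorem sum_pow_add_two_mem_iSup_ne {c : ExteriorAlgebra K V} (hc2 : c ∈ ⋀[K]^2 V) (M : ℕ) :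
    (∑ k ∈ Finset.range M, (((k + 2).factorial : K)⁻¹) • c ^ (k + 2)) ∈ ⨆ (i : ℕ) (_ : i ≠ 2), ⋀[K]^i V := by
  refine Submodule.sum_mem _ fun k _ => Submodule.smul_mem _ _ ?_
  exact Submodule.mem_iSup_of_mem (2 * (k + 2))
    (Submodule.mem_iSup_of_mem (by omega) (ExteriorLefschetz.pow_mem_exteriorPower hc2 (k + 2)))

omit [CharZero K] in
/-- **`K·x ∩ (W ⊔ e^{c}W) = 0`** for `x = a·1 + b·e^{c}`, `b ≠ 0`, `W ⊆ Λ²` a block NOT containing `c ∈ Λ²`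
(`c^N = 0`): in `w + (e^{c} - 1)w' = t·x` the degree-`2` components are `w` and `t·b·c`, so `w = tb·c`, forcing `t = 0`.
[cite: BourbakiAlgebre1a3, Ch. III §7 no. 1] -/
theorem disjoint_span_singleton_sup_map_expSum {W : Submodule K (ExteriorAlgebra K V)} (hW : W ≤ ⋀[K]^2 V)
    {c : ExteriorAlgebra K V}
    (hc : c ∈ Submodule.span K {z : ExteriorAlgebra K V | ∃ v w : V, z = ι K v * ι K w}) (hcW : c ∉ W) {N : ℕ}
    (hN : c ^ N = 0) (a : K) {b : K} (hb : b ≠ 0) :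
    Disjoint (K ∙ (algebraMap K _ a + b • ∑ k ∈ Finset.range N, ((k.factorial : K)⁻¹) • c ^ k))
      (W ⊔ W.map (LinearMap.mulLeft K (∑ k ∈ Finset.range N, ((k.factorial : K)⁻¹) • c ^ k))) := by
  have hc2 := mem_exteriorPower_two_of_mem_span_ι_mul_ι hc
  rw [← expSum_eq_of_pow_eq_zero hN (by omega : N ≤ N + 2), sup_map_mulLeft_eq_sup_map_mulLeft_sub_one,
    expSum_sub_one_eq, Submodule.disjoint_def]
  intro y hy hy'
  obtain ⟨t, rfl⟩ := Submodule.mem_span_singleton.mp hy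
  obtain ⟨w, hw, z, hz, hwz⟩ := Submodule.mem_sup.mp hy'
  obtain ⟨w', hw', rfl⟩ := Submodule.mem_map.mp hz
  rw [LinearMap.mulLeft_apply, expSum_eq_one_add_add] at hwz
  -- rearrange: (degree 2) = (degrees ≠ 2)
  set R : ExteriorAlgebra K V := ∑ k ∈ Finset.range N, (((k + 2).factorial : K)⁻¹) • c ^ (k + 2) with hR
  have h3 : w - (t * b) • c = t • algebraMap K (ExteriorAlgebra K V) a + (t * b) • (1 : ExteriorAlgebra K V) +
      (t * b) • R - (∑ k ∈ Finset.range (N + 1), (((k + 1).factorial : K)⁻¹) • c ^ (k + 1)) * w' := by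
    rw [eq_sub_of_add_eq hwz]
    simp only [smul_add, smul_smul]
    abel
  have hL : w - (t * b) • c ∈ ⋀[K]^2 V := Submodule.sub_mem _ (hW hw) (Submodule.smul_mem _ _ hc2)
  have hRt : w - (t * b) • c ∈ ⨆ (i : ℕ) (_ : i ≠ 2), ⋀[K]^i V := by
    rw [h3]
    refine Submodule.sub_mem _ (Submodule.add_mem _ (Submodule.add_mem _ (Submodule.smul_mem _ _ ?_)
      (Submodule.smul_mem _ _ ?_)) (Submodule.smul_mem _ _ (sum_pow_add_two_mem_iSup_ne hc2 N)))
      (sum_smul_pow_succ_mul_mem_iSup_ne hc2 (hW hw') (N + 1) _)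
    · exact Submodule.mem_iSup_of_mem 0 (Submodule.mem_iSup_of_mem (by omega)
        (by rw [ExteriorAlgebra.exteriorPower, pow_zero]; exact Submodule.mem_one.mpr ⟨a, rfl⟩))
    · exact Submodule.mem_iSup_of_mem 0 (Submodule.mem_iSup_of_mem (by omega)
        (by rw [ExteriorAlgebra.exteriorPower, pow_zero]; exact Submodule.mem_one.mpr ⟨1, by rw [map_one]⟩))
  have h0 : w - (t * b) • c = 0 := (disjoint_exteriorPower_iSup_ne (K := K) (V := V) 2).le_bot ⟨hL, hRt⟩
  -- `w = tb·c`; if `t ≠ 0` then `c ∈ W`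
  by_cases ht : t = 0
  · rw [ht, zero_smul]
  · exfalso
    apply hcW
    have : c = (t * b)⁻¹ • w := by
      rw [(sub_eq_zero.mp h0), smul_smul, inv_mul_cancel₀ (mul_ne_zero ht hb), one_smul]
    rw [this]
    exact Submodule.smul_mem _ _ hw

/-- **INDEPENDENCE OF THE THREE FACTOR SPANS of a theta-secant class** `x = a·1 + b·e^{c}` (`Θ` killing `L`, `c` a
twist class of `L` non-degenerate on `Θ` and NOT in the `Λ²`-block of `L`, `c^N = 0`, `a, b ≠ 0`):
`span L Θ x` (even, degrees ≥ 2), `span₁ L Θ x` (odd) and `K·x` (even) are independent — both `Fin 3` orders used by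
`finrank_span_mul_eq`. [cite: BourbakiAlgebre1a3, Ch. III §7 no. 1] [cite: BuchweitzFlenner2008HH, Prop. 6.4.4] -/
theorem iSupIndep_spans_secant {L : Set V} {Θ : Set (Module.Dual K V)} (hΘL : ∀ θ ∈ Θ, ∀ q ∈ L, θ q = 0)
    {c : ExteriorAlgebra K V}
    (hc : c ∈ Submodule.span K {z : ExteriorAlgebra K V | ∃ v : V, ∃ q ∈ L, z = ι K v * ι K q}) {N : ℕ}
    (hN : c ^ N = 0) (hcW : c ∉ wedgeBlock (K := K) L)
    (hnd : ∀ q ∈ L, ι K q ∈ Submodule.span K {y : ExteriorAlgebra K V | ∃ φ ∈ Θ, y = contractLeft φ c})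
    {a b : K} (ha : a ≠ 0) (hb : b ≠ 0) :
    iSupIndep ![span L Θ (algebraMap K _ a + b • ∑ k ∈ Finset.range N, ((k.factorial : K)⁻¹) • c ^ k),
        span₁ L Θ (algebraMap K _ a + b • ∑ k ∈ Finset.range N, ((k.factorial : K)⁻¹) • c ^ k),
        K ∙ (algebraMap K _ a + b • ∑ k ∈ Finset.range N, ((k.factorial : K)⁻¹) • c ^ k)] ∧
      iSupIndep ![K ∙ (algebraMap K _ a + b • ∑ k ∈ Finset.range N, ((k.factorial : K)⁻¹) • c ^ k),
        span₁ L Θ (algebraMap K _ a + b • ∑ k ∈ Finset.range N, ((k.factorial : K)⁻¹) • c ^ k),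
        span L Θ (algebraMap K _ a + b • ∑ k ∈ Finset.range N, ((k.factorial : K)⁻¹) • c ^ k)] := by
  have hc' := span_twist_le L hc
  set E : ExteriorAlgebra K V := ∑ k ∈ Finset.range N, ((k.factorial : K)⁻¹) • c ^ k with hE
  have hEc : ∀ z, Commute E z := commute_expSum hc' N
  have hED : ∀ φ ∈ Θ, ∀ z : ExteriorAlgebra K V, contractLeft φ (E * z) = E * (contractLeft φ z + contractLeft φ c * z) :=
    fun φ _ z => contractLeft_expSum_mul φ hc' hN z
  have hEeven : E ∈ CliffordAlgebra.evenOdd (0 : QuadraticForm K V) 0 :=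
    Submodule.sum_mem _ fun k _ => Submodule.smul_mem _ _
      (pow_mem_evenOdd_zero ((exteriorPower_le_evenOdd 2) (mem_exteriorPower_two_of_mem_span_ι_mul_ι hc')) k)
  have hx : algebraMap K _ a + b • E ∈ CliffordAlgebra.evenOdd (0 : QuadraticForm K V) 0 :=
    Submodule.add_mem _ (CliffordAlgebra.one_le_evenOdd_zero _ (Submodule.mem_one.mpr ⟨a, rfl⟩))
      (Submodule.smul_mem _ _ hEeven)
  rw [span_secant_eq hΘL hc hEc hED hnd (Ne.isUnit ha) (Ne.isUnit hb),
    span₁_secant_eq hΘL hc hEc hED hnd (Ne.isUnit ha) (Ne.isUnit hb)]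
  refine iSupIndep_three_of_parity (CliffordAlgebra.evenOdd_isCompl (0 : QuadraticForm K V)).disjoint
    ((Submodule.span_singleton_le_iff_mem _ _).mpr hx)
    (sup_map_mulLeft_le_evenOdd ((vecBlock_le L).trans (by exact_mod_cast exteriorPower_le_evenOdd (K := K) (V := V) 1))
      hEeven)
    (sup_map_mulLeft_le_evenOdd ((wedgeBlock_le L).trans (by exact_mod_cast exteriorPower_le_evenOdd (K := K) (V := V) 2))
      hEeven)
    (disjoint_span_singleton_sup_map_expSum (wedgeBlock_le L) hc' hcW hN a hb)

end Field

end ContractionSpan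

end Summit.Ventures.HSemireg

end
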